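import Literature.Analysis.FluidPDE.SerrinEnstrophyGronwall

/-!
# Crux `HodographBetchov.ClassBudgetsRegularise` (stmt-NavierStokesRegularity-16863), line `birth` —
# the weighted Gagliardo–Nirenberg key estimate and its absorption (helpers for stub 1)

The analytic half of Miller's argument (arXiv:1710.05569, proof of Thm. 1.1 = Thm. 5.2: Hölder,
Gagliardo–Nirenberg interpolation `‖∇u‖_{L^{2q'}} ≤ ‖∇u‖₂^{1−θ} ‖∇u‖₆^θ`, `θ = 3/(2q)`, Sobolev,
Young), in the form the class ledger of stub 1 consumes: the weight is an arbitrary bounded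
measurable `G ≥ 0` (in the application, the effective majorant of the middle strain eigenvalue
times the indicator of the fast velocity class) with `∫ G^p < ∞`, `p > 3/2`.

* `integral_weight_mul_norm_fderiv_apply_sq_le` — for a `C³` field `v` with `Dv, D²v ∈ L²` and
  the slice `vⱼ = ∂ⱼv`:
  `∫ G ‖vⱼ‖² ≤ ‖G‖_{L^p} (∫‖vⱼ‖²)^{1−3/(2p)} (K_S² Σᵢ∫‖∂ᵢvⱼ‖²)^{3/(2p)}`
  (Hölder with the conjugate pair `(p, p')`, Lebesgue interpolation of `∫‖vⱼ‖^{2p'}` between `2`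
  and `6`, Sobolev `‖vⱼ‖₆ ≤ K_S ‖Dvⱼ‖₂`) — the tree's Serrin key estimate
  `integral_sq_norm_mul_norm_fderiv_apply_le` with `|v|²` replaced by `G` (`ρ = 2p`);
* `two_mul_sum_integral_weight_le` — Young's absorption summed over `j`, with the
  Hessian–Laplacian identity: `2 Σⱼ ∫ G ‖vⱼ‖² ≤ (ν/2) ∫ ‖Δv‖² + κ(θ, ν) ‖G‖_{L^p}^{1/θ} ∫ |∇v|²_F`,
  `θ = 1 − 3/(2p)`, `κ(θ, ν) = θ (2(1−θ))^{(1−θ)/θ} ν^{−(1−θ)/θ} (2 K_S^{2(1−θ)})^{1/θ}`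
  (`1/θ = 2p/(2p−3)` is Miller's `p`-exponent of the `L^p_t L^q_x` class, `2θ⁻¹·… `).

References: E. Miller, Arch. Ration. Mech. Anal. 235 (2020), proof of Thm. 5.2; J. C. Robinson,
J. L. Rodrigo, W. Sadowski, *The Three-Dimensional Navier–Stokes Equations* (2016), Lemma 8.16
(proof); P. G. Lemarié-Rieusset (2016), Thm. 11.2 (proof).
-/

noncomputable section

open MeasureTheory Set Function Filter Topology InnerProductSpace
open scoped ENNReal NNReal ContDiff RealInnerProductSpace Laplacian

-- the summit and its single sub-problem share the name (CONVENTIONS §1), as in every Theorems file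
set_option linter.dupNamespace false

namespace Summit.NavierStokesRegularity.NavierStokesRegularity.Theorems.ClassBudgetsRegularise

open Literature.Analysis Literature.Analysis.FluidPDE

/-- **The weighted key estimate for one slice** (Miller 2019, proof of Thm. 5.2, the step
`∫ λ₂⁺ |∇u|² ≤ ‖λ₂⁺‖_q ‖∇u‖²_{2q'} ≤ ‖λ₂⁺‖_q ‖∇u‖₂^{2(1−θ)} ‖∇u‖₆^{2θ}`; Robinson–Rodrigo–Sadowski
2016, proof of Lemma 8.16). For a `C³` field `v` on `ℝ³` with `Dv, D²v ∈ L²`, the slice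
`vⱼ = ∂ⱼv`, and a bounded measurable weight `G ≥ 0` with `∫ G^p < ∞`, `p > 3/2`:
`∫ G ‖vⱼ‖² ≤ (∫ G^p)^{1/p} (∫ ‖vⱼ‖²)^{1−3/(2p)} (K_S² Σᵢ ∫ ‖∂ᵢvⱼ‖²)^{3/(2p)}`,
`K_S` the Sobolev constant of `‖w‖_{L⁶} ≤ K_S ‖Dw‖_{L²}`. Proof in `ℝ≥0∞`: Hölder with the
conjugate pair `(p, m/2)`, `m = 2p/(p−1)` (Mathlib `ENNReal.lintegral_mul_le_Lp_mul_Lq`), Lebesgue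
interpolation of `∫ ‖vⱼ‖^m` between `2` and `6` (`lintegral_rpow_interpolate`), Sobolev
(`eLpNorm_six_le_eLpNorm_fderiv_two`), `‖Dvⱼ‖²_{L²} ≤ Σᵢ ∫‖∂ᵢvⱼ‖²`. (The tree's
`integral_sq_norm_mul_norm_fderiv_apply_le` is the case `G = |v|²`, `ρ = 2p`.)
[cite: Miller2019, Thm 1.1 (proof of Thm 5.2)] -/
theorem integral_weight_mul_norm_fderiv_apply_sq_le
    {v : EuclideanSpace ℝ (Fin 3) → EuclideanSpace ℝ (Fin 3)} (hv : ContDiff ℝ 3 v)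
    (hv1 : ∫⁻ x, ‖iteratedFDeriv ℝ 1 v x‖ₑ ^ 2 < ⊤) (hv2 : ∫⁻ x, ‖iteratedFDeriv ℝ 2 v x‖ₑ ^ 2 < ⊤)
    {G : EuclideanSpace ℝ (Fin 3) → ℝ} (hGm : Measurable G) (hG0 : ∀ x, 0 ≤ G x) {M : ℝ}
    (hGM : ∀ x, G x ≤ M) {p : ℝ} (hp : 3 / 2 < p) (hGp : ∫⁻ x, ENNReal.ofReal (G x) ^ p < ⊤)
    (j : Fin 3) :
    ∫ x, G x * ‖fderiv ℝ v x (EuclideanSpace.basisFun (Fin 3) ℝ j)‖ ^ 2 ≤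
      ((∫⁻ x, ENNReal.ofReal (G x) ^ p) ^ (1 / p)).toReal *
        (∫ x, ‖fderiv ℝ v x (EuclideanSpace.basisFun (Fin 3) ℝ j)‖ ^ 2) ^ (1 - 3 / (2 * p)) *
        ((SNormLESNormFDerivOfEqConst (EuclideanSpace ℝ (Fin 3))
            (volume : Measure (EuclideanSpace ℝ (Fin 3))) 2 : ℝ) ^ 2 *
          ∑ i, ∫ x, ‖fderiv ℝ (fun y => fderiv ℝ v y (EuclideanSpace.basisFun (Fin 3) ℝ j)) x
            (EuclideanSpace.basisFun (Fin 3) ℝ i)‖ ^ 2) ^ (3 / (2 * p)) := by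
  -- adapted from Literature/Analysis/FluidPDE/SerrinEnstrophyGronwall.lean
  -- (`integral_sq_norm_mul_norm_fderiv_apply_le`), with the weight `|v|²` replaced by `G`
  set e := EuclideanSpace.basisFun (Fin 3) ℝ with he
  set K : ℝ≥0 := SNormLESNormFDerivOfEqConst (EuclideanSpace ℝ (Fin 3))
    (volume : Measure (EuclideanSpace ℝ (Fin 3))) 2 with hK
  -- the real exponents
  set ρ : ℝ := 2 * p with hρ
  have hρ3 : 3 < ρ := by rw [hρ]; linarith
  have hρ0 : 0 < ρ := by linarith
  have hp0 : 0 < p := by linarith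
  obtain ⟨h2m, hm6, hconj, hexpθ, hexp1⟩ := serrin_exponent_algebra hρ3
  set m : ℝ := 2 * ρ / (ρ - 2) with hm
  have hm0 : 0 < m := by linarith
  have hM0 : 0 ≤ M := (hG0 0).trans (hGM 0)
  have hρ2 : ρ / 2 = p := by rw [hρ]; ring
  have h2ρ : 2 / ρ = 1 / p := by rw [hρ]; field_simp
  have h3ρ : 3 / ρ = 3 / (2 * p) := by rw [hρ]
  -- the slice `vⱼ = ∂ⱼ v` and the second slices
  set vs : EuclideanSpace ℝ (Fin 3) → EuclideanSpace ℝ (Fin 3) := fun y => fderiv ℝ v y (e j) with hvs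
  have hvs2 : ContDiff ℝ 2 vs := (hv.fderiv_right (m := 2) (by norm_num)).clm_apply contDiff_const
  have hvs1 : ContDiff ℝ 1 vs := hvs2.of_le (by norm_num)
  have cvs : Continuous vs := hvs1.continuous
  have cdvs : ∀ i, Continuous fun x => fderiv ℝ vs x (e i) := fun i =>
    (hvs1.continuous_fderiv one_ne_zero).clm_apply continuous_const
  have n_vs : ∀ x, ‖vs x‖ ≤ ‖iteratedFDeriv ℝ 1 v x‖ := fun x => norm_fderiv_apply_basisFun_le v x j
  have n_dvs : ∀ i x, ‖fderiv ℝ vs x (e i)‖ ≤ ‖iteratedFDeriv ℝ 2 v x‖ := fun i x =>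
    (norm_fderiv_apply_basisFun_le vs x i).trans
      (norm_iteratedFDeriv_fderiv_apply_basisFun_le hv 1 (by norm_num) x j)
  have l2vs : ∫⁻ x, ‖vs x‖ₑ ^ 2 < ⊤ := lintegral_enorm_sq_lt_top_of_norm_le n_vs hv1
  have l2dvs : ∀ i, ∫⁻ x, ‖fderiv ℝ vs x (e i)‖ₑ ^ 2 < ⊤ := fun i =>
    lintegral_enorm_sq_lt_top_of_norm_le (n_dvs i) hv2
  -- the real quantities `a = ∫ ‖vⱼ‖²`, `R = Σᵢ ∫ ‖∂ᵢvⱼ‖²`, `P = ∫ G ‖vⱼ‖²`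
  have i_a : Integrable (fun x => ‖vs x‖ ^ 2) volume :=
    FluidPDE.integrable_sq_norm_of_lintegral_lt_top cvs l2vs
  have i_dd : ∀ i, Integrable (fun x => ‖fderiv ℝ vs x (e i)‖ ^ 2) volume := fun i =>
    FluidPDE.integrable_sq_norm_of_lintegral_lt_top (cdvs i) (l2dvs i)
  set a : ℝ := ∫ x, ‖vs x‖ ^ 2 with ha
  set R : ℝ := ∑ i, ∫ x, ‖fderiv ℝ vs x (e i)‖ ^ 2 with hR
  have ha0 : 0 ≤ a := integral_nonneg fun x => sq_nonneg _
  have hR0 : 0 ≤ R := Finset.sum_nonneg fun i _ => integral_nonneg fun x => sq_nonneg _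
  set g : EuclideanSpace ℝ (Fin 3) → ℝ := fun x => G x * ‖vs x‖ ^ 2 with hg
  have hg0 : ∀ x, 0 ≤ g x := fun x => mul_nonneg (hG0 x) (sq_nonneg _)
  have hgm : AEStronglyMeasurable g volume :=
    (hGm.aestronglyMeasurable.mul (cvs.norm.pow 2).aestronglyMeasurable)
  have i_g : Integrable g volume := by
    have hdom : Integrable (fun x => M * ‖vs x‖ ^ 2) volume := i_a.const_mul _
    refine hdom.mono' hgm (Eventually.of_forall fun x => ?_)
    rw [Real.norm_of_nonneg (hg0 x), hg]
    exact mul_le_mul_of_nonneg_right (hGM x) (sq_nonneg _)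
  -- `ℝ≥0∞` versions: `A = ∫⁻ ‖vⱼ‖ₑ²`, `ofReal R ≥ ‖Dvⱼ‖₂²`, `ofReal P = ∫⁻ ofReal G ‖vⱼ‖ₑ²`
  have hA : ENNReal.ofReal a = ∫⁻ x, ‖vs x‖ₑ ^ (2 : ℝ) := by
    rw [ha, ofReal_integral_eq_lintegral_ofReal i_a (Eventually.of_forall fun x => sq_nonneg _)]
    refine lintegral_congr fun x => ?_
    rw [← ofReal_norm, ENNReal.ofReal_rpow_of_nonneg (norm_nonneg _) (by norm_num), Real.rpow_two]
  have hD : eLpNorm (fderiv ℝ vs) 2 volume ^ 2 ≤ ENNReal.ofReal R := by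
    rw [← lintegral_enorm_sq_eq_eLpNorm_two_sq, hR, ← integral_finsetSum _ fun i _ => i_dd i,
      ofReal_integral_eq_lintegral_ofReal (integrable_finsetSum _ fun i _ => i_dd i)
        (Eventually.of_forall fun x => Finset.sum_nonneg fun i _ => sq_nonneg _)]
    refine lintegral_mono fun x => ?_
    rw [← ofReal_norm, ← ENNReal.ofReal_pow (norm_nonneg _)]
    exact ENNReal.ofReal_le_ofReal (FluidPDE.sq_opNorm_le_sum_sq_norm_apply e (fderiv ℝ vs x))
  have hP : ENNReal.ofReal (∫ x, g x) = ∫⁻ x, ENNReal.ofReal (G x) * ‖vs x‖ₑ ^ (2 : ℝ) := by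
    rw [ofReal_integral_eq_lintegral_ofReal i_g (Eventually.of_forall hg0)]
    refine lintegral_congr fun x => ?_
    rw [hg]
    dsimp only
    rw [ENNReal.ofReal_mul (hG0 x), ← Real.rpow_two,
      ← ENNReal.ofReal_rpow_of_nonneg (norm_nonneg _) (by norm_num), ofReal_norm]
  -- Sobolev: `∫⁻ ‖vⱼ‖ₑ⁶ ≤ (K² R)³`
  have hS : eLpNorm vs 6 volume ≤ K * eLpNorm (fderiv ℝ vs) 2 volume :=
    FluidPDE.eLpNorm_six_le_eLpNorm_fderiv_two volume finrank_euclideanSpace_fin hvs1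
      (eLpNorm_two_lt_top_of_lintegral_enorm_sq_lt_top l2vs)
  have hS6 : ∫⁻ x, ‖vs x‖ₑ ^ (6 : ℝ) ≤ ((K : ℝ≥0∞) ^ 2 * ENNReal.ofReal R) ^ (3 : ℝ) := by
    have h6 : ∫⁻ x, ‖vs x‖ₑ ^ (6 : ℝ) = eLpNorm vs 6 volume ^ (6 : ℝ) := by
      rw [eLpNorm_eq_lintegral_rpow_enorm_toReal (by norm_num) (by norm_num), ENNReal.toReal_ofNat,
        ← ENNReal.rpow_mul]
      norm_num
    rw [h6]
    calc eLpNorm vs 6 volume ^ (6 : ℝ) ≤ (K * eLpNorm (fderiv ℝ vs) 2 volume) ^ (6 : ℝ) := by gcongr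
      _ = ((K : ℝ≥0∞) ^ 2 * eLpNorm (fderiv ℝ vs) 2 volume ^ 2) ^ (3 : ℝ) := by
          rw [← mul_pow, ← ENNReal.rpow_natCast, ← ENNReal.rpow_mul]; norm_num
      _ ≤ ((K : ℝ≥0∞) ^ 2 * ENNReal.ofReal R) ^ (3 : ℝ) := by gcongr
  -- Hölder `(ρ/2, m/2)` and interpolation
  have hGae : AEMeasurable (fun x => ENNReal.ofReal (G x)) volume :=
    ENNReal.measurable_ofReal.comp_aemeasurable hGm.aemeasurable
  have hHolder : ∫⁻ x, ENNReal.ofReal (G x) * ‖vs x‖ₑ ^ (2 : ℝ) ≤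
      (∫⁻ x, ENNReal.ofReal (G x) ^ p) ^ (2 / ρ) * (∫⁻ x, ‖vs x‖ₑ ^ m) ^ (2 / m) := by
    have h := ENNReal.lintegral_mul_le_Lp_mul_Lq volume hconj
      (f := fun x => ENNReal.ofReal (G x)) (g := fun x => ‖vs x‖ₑ ^ (2 : ℝ))
      hGae (cvs.aemeasurable.enorm.pow_const _)
    have hf : ∀ x, ENNReal.ofReal (G x) ^ (ρ / 2) = ENNReal.ofReal (G x) ^ p := fun x => by
      rw [hρ2]
    have hgm' : ∀ x, (‖vs x‖ₑ ^ (2 : ℝ)) ^ (m / 2) = ‖vs x‖ₑ ^ m := fun x => by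
      rw [← ENNReal.rpow_mul]; congr 1; field_simp
    simp only [Pi.mul_apply, hf, hgm'] at h
    have e1 : 1 / (ρ / 2) = 2 / ρ := by field_simp
    have e2 : 1 / (m / 2) = 2 / m := by field_simp
    rwa [e1, e2] at h
  have hInterp : ∫⁻ x, ‖vs x‖ₑ ^ m ≤
      (∫⁻ x, ‖vs x‖ₑ ^ (2 : ℝ)) ^ ((6 - m) / (6 - 2)) * (∫⁻ x, ‖vs x‖ₑ ^ (6 : ℝ)) ^ ((m - 2) / (6 - 2)) :=
    lintegral_rpow_interpolate cvs.aemeasurable.enorm zero_lt_two (by norm_num) h2m.le hm6.le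
  -- assemble in `ℝ≥0∞`
  set NG : ℝ≥0∞ := (∫⁻ x, ENNReal.ofReal (G x) ^ p) ^ (1 / p) with hNG
  have hN : (∫⁻ x, ENNReal.ofReal (G x) ^ p) ^ (2 / ρ) = NG := by rw [hNG, h2ρ]
  have hNG_fin : NG ≠ ⊤ := ENNReal.rpow_ne_top_of_nonneg (by positivity) hGp.ne
  have hcomb : ENNReal.ofReal (∫ x, g x) ≤
      NG * (ENNReal.ofReal a ^ (1 - 3 / ρ) * ((K : ℝ≥0∞) ^ 2 * ENNReal.ofReal R) ^ (3 / ρ)) := by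
    rw [hP]
    refine hHolder.trans ?_
    rw [hN]
    gcongr
    calc (∫⁻ x, ‖vs x‖ₑ ^ m) ^ (2 / m)
        ≤ ((∫⁻ x, ‖vs x‖ₑ ^ (2 : ℝ)) ^ ((6 - m) / (6 - 2)) *
            (∫⁻ x, ‖vs x‖ₑ ^ (6 : ℝ)) ^ ((m - 2) / (6 - 2))) ^ (2 / m) := by gcongr
      _ = (∫⁻ x, ‖vs x‖ₑ ^ (2 : ℝ)) ^ (1 - 3 / ρ) * ((∫⁻ x, ‖vs x‖ₑ ^ (6 : ℝ)) ^ (1 / ρ)) := by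
          rw [ENNReal.mul_rpow_of_nonneg _ _ (by positivity), ← ENNReal.rpow_mul,
            ← ENNReal.rpow_mul, hexpθ, hexp1]
      _ ≤ (∫⁻ x, ‖vs x‖ₑ ^ (2 : ℝ)) ^ (1 - 3 / ρ) *
            ((((K : ℝ≥0∞) ^ 2 * ENNReal.ofReal R) ^ (3 : ℝ)) ^ (1 / ρ)) := by gcongr
      _ = ENNReal.ofReal a ^ (1 - 3 / ρ) * ((K : ℝ≥0∞) ^ 2 * ENNReal.ofReal R) ^ (3 / ρ) := by
          rw [hA, ← ENNReal.rpow_mul]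
          congr 2; field_simp
  -- back to reals
  have hfinR : NG * (ENNReal.ofReal a ^ (1 - 3 / ρ) *
      ((K : ℝ≥0∞) ^ 2 * ENNReal.ofReal R) ^ (3 / ρ)) ≠ ⊤ := by
    refine ENNReal.mul_ne_top hNG_fin (ENNReal.mul_ne_top ?_ ?_)
    · exact ENNReal.rpow_ne_top_of_nonneg (by rw [sub_nonneg, div_le_one hρ0]; linarith)
        ENNReal.ofReal_ne_top
    · exact ENNReal.rpow_ne_top_of_nonneg (by positivity)
        (ENNReal.mul_ne_top (ENNReal.pow_ne_top ENNReal.coe_ne_top) ENNReal.ofReal_ne_top)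
  have := (ENNReal.ofReal_le_iff_le_toReal hfinR).1 hcomb
  refine this.trans_eq ?_
  simp only [ENNReal.toReal_mul, ← ENNReal.toReal_rpow, ENNReal.toReal_pow, ENNReal.toReal_ofReal ha0,
    ENNReal.toReal_ofReal hR0, ENNReal.coe_toReal, h3ρ]
  ring

/-- **Young absorption of the weighted term into the dissipation, summed over the slices**
(Miller 2019, proof of Thm. 5.2, the step "Young ⇒ `≤ ½‖−Δu‖² + C_q ‖λ₂⁺‖_q^{p} ‖∇u‖²`";
Lemarié-Rieusset 2016, proof of Thm. 11.2). Under the hypotheses of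
`integral_weight_mul_norm_fderiv_apply_sq_le`, and with `D³v ∈ L²` (for the Hessian–Laplacian
identity `Σⱼ Σᵢ ∫‖∂ᵢ∂ⱼv‖² = ∫‖Δv‖²`), for every `ν > 0`, with `θ = 1 − 3/(2p)`:
`2 Σⱼ ∫ G ‖∂ⱼv‖² ≤ (ν/2) ∫‖Δv‖² + θ (2(1−θ))^{(1−θ)/θ} ν^{−(1−θ)/θ} (2 ‖G‖_p K_S^{2(1−θ)})^{1/θ} ∫|∇v|²_F`.
[cite: Miller2019, Thm 1.1 (proof of Thm 5.2)] -/
theorem two_mul_sum_integral_weight_le {ν : ℝ} (hν : 0 < ν)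
    {v : EuclideanSpace ℝ (Fin 3) → EuclideanSpace ℝ (Fin 3)} (hv : ContDiff ℝ 3 v)
    (hv1 : ∫⁻ x, ‖iteratedFDeriv ℝ 1 v x‖ₑ ^ 2 < ⊤) (hv2 : ∫⁻ x, ‖iteratedFDeriv ℝ 2 v x‖ₑ ^ 2 < ⊤)
    (hv3 : ∫⁻ x, ‖iteratedFDeriv ℝ 3 v x‖ₑ ^ 2 < ⊤)
    {G : EuclideanSpace ℝ (Fin 3) → ℝ} (hGm : Measurable G) (hG0 : ∀ x, 0 ≤ G x) {M : ℝ}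
    (hGM : ∀ x, G x ≤ M) {p : ℝ} (hp : 3 / 2 < p) (hGp : ∫⁻ x, ENNReal.ofReal (G x) ^ p < ⊤) :
    2 * ∑ j, ∫ x, G x * ‖fderiv ℝ v x (EuclideanSpace.basisFun (Fin 3) ℝ j)‖ ^ 2 ≤
      ν / 2 * (∫ x, ‖(Δ v) x‖ ^ 2) +
        (1 - 3 / (2 * p)) * (2 * (1 - (1 - 3 / (2 * p)))) ^ ((1 - (1 - 3 / (2 * p))) / (1 - 3 / (2 * p))) *
          ν ^ (-((1 - (1 - 3 / (2 * p))) / (1 - 3 / (2 * p)))) *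
          (2 * ((∫⁻ x, ENNReal.ofReal (G x) ^ p) ^ (1 / p)).toReal *
            ((SNormLESNormFDerivOfEqConst (EuclideanSpace ℝ (Fin 3))
              (volume : Measure (EuclideanSpace ℝ (Fin 3))) 2 : ℝ) ^ (2 * (1 - (1 - 3 / (2 * p)))))) ^
            (1 / (1 - 3 / (2 * p))) *
          ∫ x, frobeniusNormSq (fderiv ℝ v x) := by
  set e := EuclideanSpace.basisFun (Fin 3) ℝ with he
  set K : ℝ≥0 := SNormLESNormFDerivOfEqConst (EuclideanSpace ℝ (Fin 3))
    (volume : Measure (EuclideanSpace ℝ (Fin 3))) 2 with hK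
  set θ : ℝ := 1 - 3 / (2 * p) with hθ
  set N : ℝ := ((∫⁻ x, ENNReal.ofReal (G x) ^ p) ^ (1 / p)).toReal with hNdef
  have hp0 : 0 < p := by linarith
  have hθ0 : 0 < θ := by
    rw [hθ, sub_pos, div_lt_one (by positivity)]; linarith
  have hθ1 : θ < 1 := by
    rw [hθ]; linarith [div_pos (zero_lt_three' ℝ) (by positivity : (0 : ℝ) < 2 * p)]
  have h1θ : 1 - θ = 3 / (2 * p) := by rw [hθ]; ring
  have hN0 : 0 ≤ N := ENNReal.toReal_nonneg
  -- continuity / integrability of the slices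
  have hv2' : ContDiff ℝ 2 v := hv.of_le (by norm_num)
  have cdiv : ∀ i, Continuous fun x => fderiv ℝ v x (e i) := fun i =>
    (hv.continuous_fderiv (by norm_num)).clm_apply continuous_const
  have cdvs : ∀ j i, Continuous fun x => fderiv ℝ (fun y => fderiv ℝ v y (e j)) x (e i) := fun j i =>
    ((((hv.fderiv_right (m := 2) (by norm_num)).clm_apply contDiff_const).continuous_fderiv
      (by norm_num)).clm_apply continuous_const)
  have hDv_eq : ∀ x, ‖fderiv ℝ v x‖ = ‖iteratedFDeriv ℝ 1 v x‖ := fun x => by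
    rw [← norm_iteratedFDeriv_fderiv, norm_iteratedFDeriv_zero]
  have l2Dv : ∫⁻ x, ‖fderiv ℝ v x‖ₑ ^ 2 < ⊤ :=
    lintegral_enorm_sq_lt_top_of_norm_le (fun x => (hDv_eq x).le) hv1
  have l2div : ∀ i, ∫⁻ x, ‖fderiv ℝ v x (e i)‖ₑ ^ 2 < ⊤ := fun i =>
    lintegral_enorm_sq_lt_top_of_norm_le (fun x => by
      simpa [he] using (fderiv ℝ v x).le_opNorm (e i)) l2Dv
  have l2dvs : ∀ j i, ∫⁻ x, ‖fderiv ℝ (fun y => fderiv ℝ v y (e j)) x (e i)‖ₑ ^ 2 < ⊤ := fun j i =>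
    lintegral_enorm_sq_lt_top_of_norm_le (fun x =>
      (norm_fderiv_apply_basisFun_le (fun y => fderiv ℝ v y (e j)) x i).trans
        (norm_iteratedFDeriv_fderiv_apply_basisFun_le hv 1 (by norm_num) x j)) hv2
  have i_a : ∀ j, Integrable (fun x => ‖fderiv ℝ v x (e j)‖ ^ 2) volume := fun j =>
    FluidPDE.integrable_sq_norm_of_lintegral_lt_top (cdiv j) (l2div j)
  have i_dd : ∀ j i, Integrable (fun x => ‖fderiv ℝ (fun y => fderiv ℝ v y (e j)) x (e i)‖ ^ 2)
      volume := fun j i => FluidPDE.integrable_sq_norm_of_lintegral_lt_top (cdvs j i) (l2dvs j i)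
  set a : Fin 3 → ℝ := fun j => ∫ x, ‖fderiv ℝ v x (e j)‖ ^ 2 with ha
  set R : Fin 3 → ℝ := fun j => ∑ i, ∫ x, ‖fderiv ℝ (fun y => fderiv ℝ v y (e j)) x (e i)‖ ^ 2
    with hR
  set P : Fin 3 → ℝ := fun j => ∫ x, G x * ‖fderiv ℝ v x (e j)‖ ^ 2 with hP
  have ha0 : ∀ j, 0 ≤ a j := fun j => integral_nonneg fun x => sq_nonneg _
  have hR0 : ∀ j, 0 ≤ R j := fun j => Finset.sum_nonneg fun i _ => integral_nonneg fun x => sq_nonneg _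
  -- `Σⱼ aⱼ = ∫ |∇v|²_F`, `Σⱼ Rⱼ = ∫ ‖Δv‖²`
  have hsum_a : ∑ j, a j = ∫ x, FluidPDE.frobeniusNormSq (fderiv ℝ v x) := by
    rw [ha, ← integral_finsetSum _ fun j _ => i_a j]
    refine integral_congr_ae (Eventually.of_forall fun x => ?_)
    simp only
    rw [FluidPDE.frobeniusNormSq_eq_sum e]
  have hHess : ∑ j, R j = ∫ x, ‖(Δ v) x‖ ^ 2 :=
    sum_sum_integral_sq_norm_fderiv_fderiv_eq_integral_sq_norm_laplacian hv hv1 hv2 hv3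
  -- the per-slice Young absorption
  set A : ℝ := 2 * N * (K : ℝ) ^ (2 * (1 - θ)) with hAdef
  have hA0 : 0 ≤ A := by positivity
  have hstep : ∀ j, 2 * P j ≤ ν / 2 * R j +
      θ * (2 * (1 - θ)) ^ ((1 - θ) / θ) * ν ^ (-((1 - θ) / θ)) * A ^ (1 / θ) * a j := by
    intro j
    have hkey := integral_weight_mul_norm_fderiv_apply_sq_le hv hv1 hv2 hGm hG0 hGM hp hGp j
    have hkey' : P j ≤ N * a j ^ θ * ((K : ℝ) ^ 2 * R j) ^ (1 - θ) := by
      rw [h1θ]; exact hkey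
    have h1 : 2 * P j ≤ A * a j ^ θ * R j ^ (1 - θ) := by
      have hKR : ((K : ℝ) ^ 2 * R j) ^ (1 - θ) = (K : ℝ) ^ (2 * (1 - θ)) * R j ^ (1 - θ) := by
        rw [Real.mul_rpow (sq_nonneg _) (hR0 j), ← Real.rpow_natCast (K : ℝ) 2,
          ← Real.rpow_mul K.coe_nonneg]
        norm_num
      calc 2 * P j ≤ 2 * (N * a j ^ θ * ((K : ℝ) ^ 2 * R j) ^ (1 - θ)) :=
            mul_le_mul_of_nonneg_left hkey' zero_le_two
        _ = A * a j ^ θ * R j ^ (1 - θ) := by rw [hKR, hAdef]; ring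
    have h2 := mul_rpow_mul_rpow_le_absorb hθ0 hθ1 hν hA0 (hR0 j) (ha0 j)
    exact h1.trans h2
  -- sum over `j`
  have hsum : 2 * ∑ j, P j ≤ ν / 2 * ∑ j, R j +
      θ * (2 * (1 - θ)) ^ ((1 - θ) / θ) * ν ^ (-((1 - θ) / θ)) * A ^ (1 / θ) * ∑ j, a j := by
    calc 2 * ∑ j, P j = ∑ j, 2 * P j := Finset.mul_sum _ _ _
      _ ≤ ∑ j, (ν / 2 * R j +
          θ * (2 * (1 - θ)) ^ ((1 - θ) / θ) * ν ^ (-((1 - θ) / θ)) * A ^ (1 / θ) * a j) :=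
          Finset.sum_le_sum fun j _ => hstep j
      _ = ν / 2 * ∑ j, R j +
          θ * (2 * (1 - θ)) ^ ((1 - θ) / θ) * ν ^ (-((1 - θ) / θ)) * A ^ (1 / θ) * ∑ j, a j := by
          rw [Finset.sum_add_distrib, ← Finset.mul_sum, ← Finset.mul_sum]
  rw [hHess, hsum_a] at hsum
  convert hsum using 2

/-- **Weighted absorption, registered helper-stub form** (the `∀`-closed statement of
`two_mul_sum_integral_weight_le`). [cite: Miller2019, Thm 1.1 (proof of Thm 5.2)] -/
theorem weighted_absorption :
    ∀ (ν : ℝ), 0 < ν → ∀ (v : EuclideanSpace ℝ (Fin 3) → EuclideanSpace ℝ (Fin 3)), ContDiff ℝ 3 v →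
      (∫⁻ x, ‖iteratedFDeriv ℝ 1 v x‖ₑ ^ 2 < ⊤) → (∫⁻ x, ‖iteratedFDeriv ℝ 2 v x‖ₑ ^ 2 < ⊤) →
      (∫⁻ x, ‖iteratedFDeriv ℝ 3 v x‖ₑ ^ 2 < ⊤) →
      ∀ (G : EuclideanSpace ℝ (Fin 3) → ℝ), Measurable G → (∀ x, 0 ≤ G x) → (∃ M : ℝ, ∀ x, G x ≤ M) →
      ∀ p : ℝ, 3 / 2 < p → (∫⁻ x, ENNReal.ofReal (G x) ^ p < ⊤) →
      2 * ∑ j, ∫ x, G x * ‖fderiv ℝ v x (EuclideanSpace.basisFun (Fin 3) ℝ j)‖ ^ 2 ≤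
        ν / 2 * (∫ x, ‖(Δ v) x‖ ^ 2) +
          (1 - 3 / (2 * p)) * (2 * (1 - (1 - 3 / (2 * p)))) ^ ((1 - (1 - 3 / (2 * p))) / (1 - 3 / (2 * p))) *
            ν ^ (-((1 - (1 - 3 / (2 * p))) / (1 - 3 / (2 * p)))) *
            (2 * ((∫⁻ x, ENNReal.ofReal (G x) ^ p) ^ (1 / p)).toReal *
              ((SNormLESNormFDerivOfEqConst (EuclideanSpace ℝ (Fin 3))
                (MeasureTheory.volume : MeasureTheory.Measure (EuclideanSpace ℝ (Fin 3))) 2 : ℝ) ^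
                  (2 * (1 - (1 - 3 / (2 * p)))))) ^ (1 / (1 - 3 / (2 * p))) *
            ∫ x, frobeniusNormSq (fderiv ℝ v x) := by
  intro ν hν v hv hv1 hv2 hv3 G hGm hG0 hGM p hp hGp
  obtain ⟨M, hM⟩ := hGM
  exact two_mul_sum_integral_weight_le hν hv hv1 hv2 hv3 hGm hG0 hM hp hGp

end Summit.NavierStokesRegularity.NavierStokesRegularity.Theorems.ClassBudgetsRegularise

end
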